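import Mathlib
import HarnessLib
import Summits.AtomisticToContinuum.BoseEinsteinCondensation.Theses.BECConjugateDomination
import Literature.MathematicalPhysics.QuantumManyBody.PeriodicBoseGas
import Literature.MathematicalPhysics.QuantumManyBody.PeriodicBoseGasFourier

/-!
# Sketch — crux-ideate `stmt-AtomisticToContinuum-11786` (`HardCoreExtension`), ideator 2, round 1

First lemmas and transfer statements of the idea cards

* card `near-minimiser-slack-transfer` (A):
  - `energy_mono_of_le`, `uniformApproxTransfer` (PROVED): the variational monotone transfer of
    `condensateNumber` along energy-minorants `w n` of `v` with matched slack — no spectral data on `v`;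
  - `UniformSmoothClassBEC` (the transfer target C⁺), `SmoothMinorantApproximation`,
    `FiniteEnergyAtLowDensity`, and the CERTIFIED composition
    `boseEinsteinCondensation_of_uniform` : C⁺ + the two approximation facts ⇒ the conjunct,
    hence `hardCoreExtension_of_uniform` : … ⇒ `HardCoreExtension` (its hypothesis unused).
* card `third-law-current-floor` (B):
  - `SecondMomentFloor` (first lemma, an EXACT Cauchy–Schwarz/IBP inequality for every real
    periodic state: `(N k²)² ≤ (N S_k)·(4 D_k + N k⁴ (2 − S_k))`, `D_k = ‖Σ_j e_m(x_j)(k·∇_j)Ψ‖²`);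
  - `UniformCurrentFluctuationBound` (the load-bearing input CFB: `D_k ≤ C·a(v)·ρ·|k|²·N`).
-/

noncomputable section

open MeasureTheory Filter
open scoped ENNReal Topology

namespace Summit.AtomisticToContinuum.BoseEinsteinCondensation.Cruxes.HardCoreExtension.IdeatorTwo

open Literature.MathematicalPhysics.QuantumManyBody.BoseGas
open Summit.AtomisticToContinuum.BoseEinsteinCondensation.Theses.BECConjugateDomination

/-! ## Card A — near-minimiser slack transfer -/

/-- The Dirichlet energy is monotone in the pair potential (pointwise order). -/
theorem energy_mono_of_le {N : ℕ} {L : ℝ} {v w : ℝ → ℝ≥0∞} (h : ∀ r, w r ≤ v r)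
    (Ψ : TrialState N L) : energy w Ψ ≤ energy v Ψ := by
  unfold energy
  refine lintegral_mono fun X => ?_
  gcongr
  unfold interaction
  gcongr with i _ j _
  exact h _

/-- **Uniform approximation transfer (UAT).** If every `w n` has energy below that of `v` state by
state, the ground-state energies of the `w n` approximate that of `v` from below, and for ONE slack
`δ > 0` all `δ`-near-minimisers of all `w n` have `λ_max ≥ m`, then `condensateNumber v ≥ m`.
The trial class `TrialState N L` does not depend on the potential, so a `δ/2`-near-minimiser of
`v` is a `δ`-near-minimiser of `w n` for `n` large: no spectral information on `v` is needed. -/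
theorem uniformApproxTransfer {N : ℕ} {L : ℝ} (v : ℝ → ℝ≥0∞) (w : ℕ → ℝ → ℝ≥0∞) (m : ℝ≥0∞)
    (hle : ∀ n, ∀ Ψ : TrialState N L, energy (w n) Ψ ≤ energy v Ψ)
    (happrox : ∀ ε : ℝ≥0∞, 0 < ε → ∃ n, groundStateEnergy v N L ≤ groundStateEnergy (w n) N L + ε)
    (hunif : ∃ δ : ℝ≥0∞, 0 < δ ∧ ∀ n, ∀ Φ : TrialState N L,
        energy (w n) Φ ≤ groundStateEnergy (w n) N L + δ → m ≤ maxOccupation N Φ.ψ) :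
    m ≤ condensateNumber v N L := by
  obtain ⟨δ, hδ, h⟩ := hunif
  have hδ2 : 0 < δ / 2 := ENNReal.half_pos hδ.ne'
  obtain ⟨n, hn⟩ := happrox (δ / 2) hδ2
  refine le_condensateNumber v hδ2 fun Ψ hΨ => h n Ψ ?_
  calc energy (w n) Ψ ≤ energy v Ψ := hle n Ψ
    _ ≤ groundStateEnergy v N L + δ / 2 := hΨ
    _ ≤ groundStateEnergy (w n) N L + δ / 2 + δ / 2 := add_le_add hn le_rfl
    _ = groundStateEnergy (w n) N L + δ := by rw [add_assoc, ENNReal.add_halves]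

/-- The smooth class of the route (finite, `C²` radial, edge condition), with range `≤ R`. -/
def IsSmoothClass (R : ℝ) (v : ℝ → ℝ≥0∞) : Prop :=
  IsRepulsiveFiniteRange v ∧ (∀ r, v r ≠ ⊤) ∧ ContDiff ℝ 2 (fun x : Space => (v ‖x‖).toReal) ∧
    (∃ Cₑ : ℝ, ∀ x : Space,
      ‖iteratedFDeriv ℝ 2 (fun x : Space => (v ‖x‖).toReal) x‖ ≤ Cₑ * Real.sqrt ((v ‖x‖).toReal)) ∧
    (∀ r, R < r → v r = 0)

/-- **Transfer target C⁺ (card A).** BEC for the smooth class with constants uniform in the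
potential at fixed range bound `R` (the scattering length is then automatically `≤ R`):
`ρ₀, c, N₀` uniform (thermodynamic content) and, at each fixed `N`, ONE slack `δ` for the whole
class (fixed-volume content: Γ-compactness of nonnegative pair measures of range `≤ R` plus
simplicity of every limiting ground state). -/
def UniformSmoothClassBEC : Prop :=
  ∀ R : ℝ, 0 < R → ∃ ρ₀ : ℝ, 0 < ρ₀ ∧ ∀ ρ : ℝ, 0 < ρ → ρ < ρ₀ → ∃ c : ℝ, 0 < c ∧
    ∀ᶠ N : ℕ in atTop, ∃ δ : ℝ≥0∞, 0 < δ ∧ ∀ v : ℝ → ℝ≥0∞, IsSmoothClass R v →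
      ∀ Ψ : TrialState N (sideLength ρ N),
        energy v Ψ ≤ groundStateEnergy v N (sideLength ρ N) + δ →
          ENNReal.ofReal (c * N) ≤ maxOccupation N Ψ.ψ

/-- **Smooth energy-minorants (card A, support).** Every LOWER SEMICONTINUOUS repulsive
finite-range potential (hard cores `⊤·1_{[0,a)}`, open hard shells, continuous soft cores, steps
made lsc at their jumps …) admits smooth-class energy-minorants of a common range whose Dirichlet
ground-state energies approximate its own from below at every finite `(N, L)` (lsc `v` = increasing
sup of `φᵢ²`, `φᵢ ∈ C_c^∞` radial — these satisfy the edge condition by Glaeser's inequality; then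
monotone convergence of the closed forms + compactness at fixed volume). FALSE without
semicontinuity: for `v = 1_K`, `K ⊂ [1,2]` nowhere dense of positive measure, every continuous
minorant vanishes on `[1,2]` while `E₀(v) > E₀(0)`. -/
def SmoothMinorantApproximation : Prop :=
  ∀ v : ℝ → ℝ≥0∞, IsRepulsiveFiniteRange v → LowerSemicontinuous v → ∃ R : ℝ, 0 < R ∧
    ∃ w : ℕ → ℝ → ℝ≥0∞,
    (∀ i, IsSmoothClass R (w i)) ∧
    (∀ i (N : ℕ) (L : ℝ) (Ψ : TrialState N L), energy (w i) Ψ ≤ energy v Ψ) ∧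
    ∀ (N : ℕ) (L : ℝ), 0 < L → groundStateEnergy v N L ≠ ⊤ →
      ∀ ε : ℝ≥0∞, 0 < ε → ∃ i, groundStateEnergy v N L ≤ groundStateEnergy (w i) N L + ε

/-- **Finite energy at low density (card A, support; free-volume states).** -/
def FiniteEnergyAtLowDensity : Prop :=
  ∀ v : ℝ → ℝ≥0∞, IsRepulsiveFiniteRange v → ∃ ρ₀ : ℝ, 0 < ρ₀ ∧ ∀ ρ : ℝ, 0 < ρ → ρ < ρ₀ →
    ∀ᶠ N : ℕ in atTop, 0 < sideLength ρ N ∧ groundStateEnergy v N (sideLength ρ N) ≠ ⊤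

/-- **Certified composition (card A), lower semicontinuous potentials.** C⁺ and the two
approximation facts give ground-state BEC at all small densities for EVERY lsc repulsive
finite-range potential (hard cores, hard shells, kinks, soft cores), by `uniformApproxTransfer`. -/
theorem hasGroundStateBEC_lsc_of_uniform (hU : UniformSmoothClassBEC)
    (hA : SmoothMinorantApproximation) (hF : FiniteEnergyAtLowDensity)
    (v : ℝ → ℝ≥0∞) (hv : IsRepulsiveFiniteRange v) (hlsc : LowerSemicontinuous v) :
    ∃ ρ₀ : ℝ, 0 < ρ₀ ∧ ∀ ρ : ℝ, 0 < ρ → ρ < ρ₀ → HasGroundStateBEC v ρ := by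
  obtain ⟨R, hR, w, hw, hle, happ⟩ := hA v hv hlsc
  obtain ⟨ρ₁, hρ₁, hU⟩ := hU R hR
  obtain ⟨ρ₂, hρ₂, hF⟩ := hF v hv
  refine ⟨min ρ₁ ρ₂, lt_min hρ₁ hρ₂, fun ρ hρ hρlt => ?_⟩
  obtain ⟨c, hc, hN⟩ := hU ρ hρ (hρlt.trans_le (min_le_left _ _))
  refine ⟨c, hc, ?_⟩
  filter_upwards [hN, hF ρ hρ (hρlt.trans_le (min_le_right _ _))] with N hδ hfin
  obtain ⟨δ, hδ, hall⟩ := hδ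
  exact uniformApproxTransfer v w _ (fun n Ψ => hle n N _ Ψ)
    (fun ε hε => happ N _ hfin.1 hfin.2 ε hε) ⟨δ, hδ, fun n Φ hΦ => hall (w n) (hw n) Φ hΦ⟩

/-- **Null modifications of the radial profile are invisible** (card A, support; the set of
configurations with some `|xᵢ - xⱼ|` in a Lebesgue-null set of radii is null in `(ℝ³)^N`, so all
energies, hence `condensateNumber`, agree). -/
def AeRadialInvariance : Prop :=
  ∀ v v' : ℝ → ℝ≥0∞, (∀ᵐ r ∂(volume.restrict (Set.Ioi (0 : ℝ))), v r = v' r) →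
    ∀ ρ : ℝ, HasGroundStateBEC v ρ ↔ HasGroundStateBEC v' ρ

/-- **The residue this line does NOT reach** (card A, flagged): repulsive finite-range profiles with
no lower-semicontinuous representative modulo null sets of radii (e.g. `V₀·1_K`, `K` a fat Cantor
set): bounded, hard-set-free, physically harmless, but not approached IN ENERGY by smooth minorants,
and majorants transfer nothing (adverse direction). Stated as the conclusion on that class. -/
def NonLscResidueBEC : Prop :=
  ∀ v : ℝ → ℝ≥0∞, IsRepulsiveFiniteRange v →
    (¬ ∃ v' : ℝ → ℝ≥0∞, IsRepulsiveFiniteRange v' ∧ LowerSemicontinuous v' ∧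
        ∀ᵐ r ∂(volume.restrict (Set.Ioi (0 : ℝ))), v r = v' r) →
    ∃ ρ₀ : ℝ, 0 < ρ₀ ∧ ∀ ρ : ℝ, 0 < ρ → ρ < ρ₀ → HasGroundStateBEC v ρ

/-- **Certified composition to the crux** (its non-uniform hypothesis unused — the honest shape
of any approximation proof of `HardCoreExtension`; the last hypothesis is the flagged residue). -/
theorem hardCoreExtension_of_uniform (hU : UniformSmoothClassBEC)
    (hA : SmoothMinorantApproximation) (hF : FiniteEnergyAtLowDensity)
    (hI : AeRadialInvariance) (hZ : NonLscResidueBEC) : HardCoreExtension := by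
  intro _ v hv
  by_cases h : ∃ v' : ℝ → ℝ≥0∞, IsRepulsiveFiniteRange v' ∧ LowerSemicontinuous v' ∧
      ∀ᵐ r ∂(volume.restrict (Set.Ioi (0 : ℝ))), v r = v' r
  · obtain ⟨v', hv', hlsc, hae⟩ := h
    obtain ⟨ρ₀, hρ₀, hB⟩ := hasGroundStateBEC_lsc_of_uniform hU hA hF v' hv' hlsc
    exact ⟨ρ₀, hρ₀, fun ρ hρ hlt => (hI v v' hae ρ).2 (hB ρ hρ hlt)⟩
  · exact hZ v hv h

/-! ## Card B — third-law current floor -/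

/-- **First lemma (card B): the second-moment floor, exact for every real periodic state.**
For `Ψ` real, periodic, `C¹`, normalised on the cell, and `k = 2πm/L ≠ 0`:
`(N|k|²)² ≤ (N S_k) · (4 D_k + N|k|⁴(2 − S_k))`, where `S_k = N⁻¹∫|Σ_j e_m(x_j)|²Ψ²` is the static
structure factor and `D_k = ∫|Σ_j e_m(x_j) (k·∇_j)Ψ|²` the longitudinal current fluctuation.
Proof on paper: `A := Σ_j e_m(x_j)(|k|²Ψ − 2i k·∇_jΨ)` (= `[H,ρ_k]Ψ`, no Laplacian needed);
one integration by parts on the torus gives `Re⟨ρ_kΨ, A⟩ = N|k|²` and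
`‖A‖² = 4D_k + N|k|⁴(2 − S_k)` identically; then Cauchy–Schwarz. Equivalently
`|k|⁴(1 − S_k)² ≤ 4 S_k D_k / N`, i.e. `S_k ≥ min(½, N|k|⁴/(16 D_k))`. -/
def SecondMomentFloor : Prop :=
  ∀ (n : ℕ) (L : ℝ), 0 < L → ∀ Ψ : PeriodicTrialState (n + 1) L,
    (∀ X, Ψ.ψ X = ((Ψ.ψ X).re : ℂ)) →
    ∀ m : Fin 3 → ℤ, m ≠ 0 →
      let Nr : ℝ := (n : ℝ) + 1
      let k : Space := (2 * Real.pi / L) • latticeVec 1 m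
      let S : ℝ := Nr⁻¹ *
        ∫ X in cellN (n + 1) L, ‖∑ j : Fin (n + 1), cellWave L m (X j)‖ ^ 2 * ‖Ψ.ψ X‖ ^ 2
      let D : ℝ := ∫ X in cellN (n + 1) L,
        ‖∑ j : Fin (n + 1), cellWave L m (X j) * fderiv ℝ Ψ.ψ X (Pi.single j k)‖ ^ 2
      (Nr * ‖k‖ ^ 2) ^ 2 ≤ (Nr * S) * (4 * D + Nr * ‖k‖ ^ 4 * (2 - S))

/-- **Load-bearing input of card B (CFB), uniform over the smooth class of range `≤ R`.**
For the positive minimiser on the torus at density `ρ < ρ₀`, every nonzero mode `k = 2πm/L`: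
`D_k = ‖Σ_j e_m(x_j)(k·∇_j)Ψ‖² ≤ C · a(v) · ρ · |k|² · N` — the "force structure factor" is
bounded by the kinetic-energy scale `aρ` per particle, uniformly in `k`, `N`, and in `v` through
its scattering length only. Its diagonal part is `|k|²T_L ≤ (4π/3)aρ|k|²N(1+o(1))` (LSSY Thm 2.2);
at `k = 0` it vanishes identically (`Σ_j ∇_jΨ = 0`, translation invariance = Newton's third law);
Bogoliubov: `D_k/(N|k|²) = |k|²n_k + O(ρa√(ρa³)) ≤ 0.086·8πρa`. -/
def UniformCurrentFluctuationBound : Prop :=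
  ∀ R : ℝ, 0 < R → ∃ C : ℝ, 0 ≤ C ∧ ∃ ρ₀ : ℝ, 0 < ρ₀ ∧ ∀ ρ : ℝ, 0 < ρ → ρ < ρ₀ →
    ∀ᶠ n : ℕ in atTop, ∀ v : ℝ → ℝ≥0∞, IsSmoothClass R v →
      ∀ Ψ : PeriodicTrialState (n + 1) (sideLength ρ (n + 1)),
        (let L : ℝ := sideLength ρ (n + 1)
         periodicEnergy v Ψ = periodicGroundStateEnergy v (n + 1) L → periodicEnergy v Ψ ≠ ⊤ →
         (∀ X, Ψ.ψ X = (‖Ψ.ψ X‖ : ℂ)) → (∀ X, Ψ.ψ X ≠ 0) →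
         ∀ m : Fin 3 → ℤ, m ≠ 0 →
           let k : Space := (2 * Real.pi / L) • latticeVec 1 m
           ∫ X in cellN (n + 1) L,
               ‖∑ j : Fin (n + 1), cellWave L m (X j) * fderiv ℝ Ψ.ψ X (Pi.single j k)‖ ^ 2
             ≤ C * (scatteringLength v).toReal * ρ * ‖k‖ ^ 2 * ((n : ℝ) + 1))

/-- The floor card B feeds into the route's glue in place of `PuffFloor`:
`S_k ≥ min(½, |k|²/(16 C a ρ))` for every nonzero mode, uniformly over the smooth class. -/
def UniformQuadraticFloor : Prop :=
  ∀ R : ℝ, 0 < R → ∃ C : ℝ, 0 < C ∧ ∃ ρ₀ : ℝ, 0 < ρ₀ ∧ ∀ ρ : ℝ, 0 < ρ → ρ < ρ₀ →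
    ∀ᶠ n : ℕ in atTop, ∀ v : ℝ → ℝ≥0∞, IsSmoothClass R v →
      ∀ Ψ : PeriodicTrialState (n + 1) (sideLength ρ (n + 1)),
        (let L : ℝ := sideLength ρ (n + 1)
         let S : (Fin 3 → ℤ) → ℝ := fun m => ((n : ℝ) + 1)⁻¹ *
           ∫ X in cellN (n + 1) L, ‖∑ j : Fin (n + 1), cellWave L m (X j)‖ ^ 2 * ‖Ψ.ψ X‖ ^ 2
         let kn : (Fin 3 → ℤ) → ℝ := fun m => ‖((2 * Real.pi / L) • latticeVec 1 m)‖
         periodicEnergy v Ψ = periodicGroundStateEnergy v (n + 1) L → periodicEnergy v Ψ ≠ ⊤ →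
         (∀ X, Ψ.ψ X = (‖Ψ.ψ X‖ : ℂ)) → (∀ X, Ψ.ψ X ≠ 0) →
         ∀ m : Fin 3 → ℤ, m ≠ 0 →
           min (1 / 2) (kn m ^ 2 / (16 * C * (scatteringLength v).toReal * ρ)) ≤ S m)

end Summit.AtomisticToContinuum.BoseEinsteinCondensation.Cruxes.HardCoreExtension.IdeatorTwo
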